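import Summits.ResolutionOfSingularities.ResolutionOfSingularities.Theorems.SandwichedSingularitiesResolution
import Summits.ResolutionOfSingularities.ResolutionOfSingularities.Theorems.RegularBlowupsDesingularization
import Literature.AlgebraicGeometry.Morphisms.NagataCompactificationProofs
import Literature.AlgebraicGeometry.Resolution.ProperModelsPatching
import Literature.AlgebraicGeometry.Resolution.BlowupsComposition
import Literature.AlgebraicGeometry.Resolution.NonPrincipalLocus
import Literature.AlgebraicGeometry.Resolution.RegularLocusDense
import HarnessLib

/-!
# Crux `PatchingRel` (stmt-ResolutionOfSingularities-0642), line `sandwiched-gluing` (v3 cut, cycle 4):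
# the FORMAT UPGRADE — strong resolution + Axiom 4 ⇒ Sing-admissible blow-up desingularization

The v3 cut reduced Zariski's patching, with nothing owed to compactification or gluing, to the
atom SAND⁺ᵇ(p) (`SandwichedStrongBlowupResolution p`): a sandwiched variety `V` admits ONE
blowing up `Bl_J V`, `V(J) ⊆ Sing V`, with regular source. Its only slack against the gen-0 atom
SAND⁺(p) (`SandwichedStrongResolution p`: an abstract strong resolution `φ : Y → V`, proper
birational, `Y` regular, an isomorphism over `Reg V`) is the FORMAT. This file PROVES that the
format costs at most Piltant's Axiom 4 in blow-up format (`PrincipalizationInChar p`,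
`Theorems/RegularBlowupsDesingularization.lean`):

  `SandwichedStrongResolution p → PrincipalizationInChar p → SandwichedStrongBlowupResolution p`.

Proof (`sandwichedStrongBlowupResolution_of_strong_of_principalization`). Let `φ : Y → V` be a
strong resolution. By Raynaud–Gruson's theory of `U`-admissible blowing ups in the form of
Stacks 081T + 080E (tree theorem `Literature.AlgebraicGeometry.Morphisms.exists_isBlowup_dominating`,
unconditional) there are a `Reg V`-admissible blowing up `b : V' = Bl_I V → V` (`V(I) = Sing V`)
and `r : V' → Y` with `r ≫ φ = b`, `r` the blowing up of `Y` along `I' := φ⁻¹I 𝒪_Y`. So `V'` is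
a blowing up of the REGULAR variety `Y`; Axiom 4 principalizes `I'` by a blowing up
`Bl_Q Y → Y` with regular source, `V(Q) ⊆ V(I')`, and then (Stacks 080A read backwards,
`exists_isBlowup_comap_isRegular`) `Bl_{r⁻¹Q} V'` is regular, with `V(r⁻¹Q) ⊆ r⁻¹V(I') =
b⁻¹(Sing V)`. Finally a `Sing V`-supported blowing up followed by a blowing up cosupported over
`Sing V` is ONE `Sing V`-supported blowing up (Temkin 2008, Lemma 2.1.4 =
`IsBlowup.exists_isBlowup_comp_supported`), whose source `Bl_{r⁻¹Q} V'` is regular.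

Consequences. As a reduction of the crux this adds nothing (SAND⁺ alone already gives
`PatchingRel`, `patchingRel_of_sandwichedStrong`, Nagata compactification being a theorem of the
tree); its content is the RELATION between the atoms: the blow-up-format atom SAND⁺ᵇ, for which
patching needs no compactification, no gluing and no bad points, is at most "strong resolution +
Axiom 4" — two standard outputs of any resolution programme. In dimension 3, where SAND⁺ is
Cossart–Piltant 2019 Thm. 1.1 as printed (`CossartPiltant2019General`) and Axiom 4 is their
Prop. 4.4 (`CossartPiltant2019Principalization`), the blow-up-format atoms are therefore known
modulo those vendored facts (sibling file, dimension-3 corollary).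

## References

* O. Piltant, *An axiomatic version of Zariski's patching theorem*, RACSAM 107 (2013) 91–121,
  §2 Axiom 4, Prop. 5.1. [Piltant2013]
* B. Conrad, *Deligne's notes on Nagata compactifications*, J. Ramanujan Math. Soc. 22 (2007),
  Thm. 2.11, Remark 2.12. [Conrad2007]
* M. Temkin, *Desingularization of quasi-excellent schemes in characteristic zero*, Adv. Math.
  219 (2008), Lemma 2.1.4. [Temkin2008]
* The Stacks Project, Tags 080A, 080E, 081T. [StacksProject]
-/

-- `Summit.<Summit>.<Sub>.Theorems` with `Sub = Summit` (single-conjunct summit, D-0017): the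
-- duplicated namespace component is the tree layout.
set_option linter.dupNamespace false

noncomputable section

namespace Summit.ResolutionOfSingularities.ResolutionOfSingularities.Theorems

open CategoryTheory AlgebraicGeometry TopologicalSpace
open Literature.AlgebraicGeometry.Resolution Literature.AlgebraicGeometry.Morphisms

universe u

/-- **A strong resolution plus a principalization on its source give a Sing-admissible blow-up
desingularization.** Let `V` be an integral Noetherian scheme, `W ⊆ V` an open containing the
generic point (the regular locus), `φ : Y → V` proper with `Y` integral, an isomorphism over `W`,
and suppose every non-zero ideal sheaf on `Y` is principalized by a blowing up with regular
source cosupported in its zero locus (Axiom 4 on `Y`). Then `V` carries a non-zero ideal sheaf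
`Q'` with `V(Q') ⊆ V ∖ W` whose blowing up has regular source: `U`-admissible domination
(Stacks 081T + 080E) makes `Bl_I V`, `V(I) = V ∖ W`, a blowing up of `Y`; Axiom 4 and Stacks 080A
desingularise it by a blowing up cosupported over `V ∖ W`; the composite is one blowing up
cosupported in `V ∖ W` (Temkin 2008, Lemma 2.1.4). [cite: StacksProject, Tag 081T]
[cite: Temkin2008, Lemma 2.1.4] -/
theorem exists_isBlowup_supported_isRegular_of_isIso_over {V Y : Scheme.{u}} [IsIntegral V]
    [IsNoetherian V] [IsIntegral Y] (φ : Y ⟶ V) [IsProper φ] (W : V.Opens)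
    (hW : genericPoint V ∈ W) [IsIso (φ ∣_ W)]
    (hA4 : ∀ I' : Y.IdealSheafData, I' ≠ ⊥ →
      ∃ (Q : Y.IdealSheafData) (Y₁ : Scheme.{u}) (σ : Y₁ ⟶ Y),
        (Q.support : Set Y) ⊆ I'.support ∧ IsBlowup σ Q ∧ Scheme.IsRegular Y₁ ∧
          IsEffectiveCartier (I'.comap σ)) :
    ∃ (Q' : V.IdealSheafData) (V'' : Scheme.{u}) (ρ : V'' ⟶ V),
      Q' ≠ ⊥ ∧ (Q'.support : Set V) ⊆ (W : Set V)ᶜ ∧ IsBlowup ρ Q' ∧ Scheme.IsRegular V'' := by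
  -- `W`-admissible domination: `b : V' = Bl_I V → V`, `V(I) = V ∖ W`, and `r : V' → Y`, a blowing
  -- up of `Y` along `I' := φ⁻¹ I`
  have hWc : IsCompact (W : Set V) := NoetherianSpace.isCompact _
  obtain ⟨I, V', b, r, -, hsupp, hb, hrφ, hr⟩ := exists_isBlowup_dominating φ W hWc
  -- `I' ≠ 0`: a point of `Y` over the generic point of `V` (which lies in `W`, over which `φ`
  -- is an isomorphism) is not in `V(I') = φ⁻¹ V(I) = φ⁻¹ (V ∖ W)`
  have hI' : I.comap φ ≠ ⊥ := by
    intro h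
    have h1 : ((I.comap φ).support : Set Y) = Set.univ := by
      rw [h, Scheme.IdealSheafData.support_bot]; rfl
    rw [Scheme.IdealSheafData.support_comap] at h1
    obtain ⟨y, hy⟩ := (ConcreteCategory.bijective_of_isIso (φ ∣_ W).base).2 ⟨_, hW⟩
    have hφy : φ ((φ ⁻¹ᵁ W).ι y) = genericPoint V := by
      have := morphismRestrict_base_coe φ W y
      rw [hy] at this
      exact this.symm
    have hmem : (φ ⁻¹ᵁ W).ι y ∈ (TopologicalSpace.Closeds.preimage I.support φ.continuous :
        Set Y) := by rw [h1]; trivial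
    rw [TopologicalSpace.Closeds.coe_preimage, Set.mem_preimage, hφy, hsupp] at hmem
    exact hmem hW
  -- Axiom 4 on `Y`: principalize `I'`
  obtain ⟨Q, Y₁, σ, hQI, hσ, hreg, hcart⟩ := hA4 (I.comap φ) hI'
  -- Stacks 080A backwards: `Bl_{r⁻¹Q} V'` is regular
  obtain ⟨V'', π, hπ, hreg''⟩ := exists_isBlowup_comap_isRegular hσ hreg hcart hr
  -- supports: `V(I) = V ∖ W` and `V(r⁻¹Q) ⊆ r⁻¹ V(I') = b⁻¹ V(I)`
  have hIT : (I.support : Set V) ⊆ (W : Set V)ᶜ := by rw [hsupp]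
  have hJT : ((Q.comap r).support : Set V') ⊆ b ⁻¹' (W : Set V)ᶜ := by
    intro v hv
    rw [Scheme.IdealSheafData.support_comap] at hv
    have hv' : r v ∈ ((I.comap φ).support : Set Y) := hQI hv
    rw [Scheme.IdealSheafData.support_comap] at hv'
    change φ (r v) ∈ (I.support : Set V) at hv'
    rw [← Scheme.Hom.comp_apply, hrφ, hsupp] at hv'
    exact hv'
  -- Temkin 2.1.4: the composite is ONE `(V ∖ W)`-supported blowing up
  obtain ⟨Q', hQ', hQ'T⟩ :=
    hb.exists_isBlowup_comp_supported b I π (Q.comap r) ((W : Set V)ᶜ) hIT hπ hJT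
  refine ⟨Q', V'', π ≫ b, ?_, hQ'T, hQ', hreg''⟩
  -- `Q' ≠ 0`: its cosupport misses the generic point
  intro h
  have h1 : (Q'.support : Set V) = Set.univ := by
    rw [h, Scheme.IdealSheafData.support_bot]; rfl
  have : genericPoint V ∈ (Q'.support : Set V) := by rw [h1]; trivial
  exact hQ'T this hW

/-- **THE FORMAT UPGRADE: SAND⁺(p) ∧ Axiom 4ᵇ(p) ⇒ SAND⁺ᵇ(p).** A strong resolution of a
sandwiched variety (the gen-0 atom `SandwichedStrongResolution p`: proper birational from a
regular scheme, an isomorphism over `Reg V`) together with principalization on regular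
varieties in blow-up format (`PrincipalizationInChar p`, Piltant's Axiom 4, all dimensions)
give a Sing-admissible blow-up desingularization of the sandwiched variety (the v3 atom
`SandwichedStrongBlowupResolution p`) — via Raynaud–Gruson `U`-admissible domination
(Stacks 081T, tree theorem `exists_isBlowup_dominating`), Stacks 080A read backwards and
Temkin's Lemma 2.1.4. [cite: StacksProject, Tag 081T] [cite: Piltant2013, §2 Axiom 4]
[cite: Temkin2008, Lemma 2.1.4] -/
theorem sandwichedStrongBlowupResolution_of_strong_of_principalization {p : ℕ}
    (hS : SandwichedStrongResolution.{u} p) (hA : PrincipalizationInChar.{u} p) :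
    SandwichedStrongBlowupResolution.{u} p := by
  intro k _ _ U V f η hf₁ hf₂ hf₃ hU hUreg hV hη hbir
  haveI := hf₁; haveI := hf₂; haveI := hf₃; haveI := hU; haveI := hV; haveI := hη
  -- `V` is an integral Noetherian scheme of finite type over `k`
  let g : V ⟶ Spec (.of k) := η ≫ f
  haveI : IsLocallyNoetherian V := LocallyOfFiniteType.isLocallyNoetherian g
  haveI : CompactSpace V := QuasiCompact.compactSpace_of_compactSpace g
  haveI : IsNoetherian V := {}
  -- the strong resolution
  obtain ⟨Y, φ, hres, W, hW, hiso⟩ := hS k U V f η hf₁ hf₂ hf₃ hU hUreg hV hη hbir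
  haveI := hres.isProper
  haveI := hiso
  haveI : IsIntegral Y := by
    haveI := hres.isRegular.isReduced
    exact hres.isBirational.isIntegral
  have hgenW : genericPoint V ∈ W := by
    show genericPoint V ∈ (W : Set V)
    rw [hW]
    apply Scheme.genericPoints_subset_regularLocus
    rw [genericPoints_eq_singleton]
    rfl
  -- Axiom 4 on the regular variety `Y` (separated and of finite type over `k` via `φ ≫ g`)
  have hA4 : ∀ I' : Y.IdealSheafData, I' ≠ ⊥ →
      ∃ (Q : Y.IdealSheafData) (Y₁ : Scheme.{u}) (σ : Y₁ ⟶ Y),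
        (Q.support : Set Y) ⊆ I'.support ∧ IsBlowup σ Q ∧ Scheme.IsRegular Y₁ ∧
          IsEffectiveCartier (I'.comap σ) := fun I' hI' =>
    hA k Y (φ ≫ g) inferInstance inferInstance inferInstance inferInstance hres.isRegular I' hI'
  obtain ⟨Q', V'', ρ, hQ', hQ'T, hρ, hreg''⟩ :=
    exists_isBlowup_supported_isRegular_of_isIso_over φ W hgenW hA4
  refine ⟨Q', V'', ρ, hQ', fun x hx hxreg => ?_, hρ, hreg''⟩
  have : x ∈ (W : Set V) := by rw [hW]; exact hxreg
  exact hQ'T hx this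

/-- **Registered stub of line `sandwiched-gluing` (v3 cut, cycle 4)** (crux
stmt-ResolutionOfSingularities-0642, universe `0`): SAND⁺(p) ∧ Axiom 4ᵇ(p) ⇒ SAND⁺ᵇ(p).
[cite: StacksProject, Tag 081T] -/
theorem stub_sandwichedStrongBlowup_of_strong_of_principalization :
    ∀ p : ℕ, SandwichedStrongResolution.{0} p → PrincipalizationInChar.{0} p →
      SandwichedStrongBlowupResolution.{0} p :=
  fun _ hS hA => sandwichedStrongBlowupResolution_of_strong_of_principalization hS hA

end Summit.ResolutionOfSingularities.ResolutionOfSingularities.Theorems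

end
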